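import Summits.AnomalousDissipation.AnomalousDissipation.Theorems.BaireTransferRobustLoudUpgradeLine
import Summits.AnomalousDissipation.AnomalousDissipation.Theorems.BaireTransferRobustLoudUpgradeStubSteadyPersist
import Summits.AnomalousDissipation.AnomalousDissipation.Theorems.BaireTransferRobustLoudUpgradeStubPeriodicWindow
import Summits.AnomalousDissipation.AnomalousDissipation.Theorems.BaireTransferRobustLoudUpgradePeriodicPersistOfHenry
import Literature.Analysis.FluidPDE.PeriodicNSOrbitPersistsProofs
import Literature.Analysis.FluidPDE.LongTimeAverageNonneg
import Summits.AnomalousDissipation.AnomalousDissipation.Theorems.BaireTransferRobustLoudUpgradeStubWindowExhaust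
import Summits.AnomalousDissipation.AnomalousDissipation.Theorems.BaireTransferRobustLoudUpgradeStubOrbitInW
import Summits.AnomalousDissipation.AnomalousDissipation.Theorems.BaireTransferRobustLoudUpgradeStubLimitEquation
import Summits.AnomalousDissipation.AnomalousDissipation.Theorems.BaireTransferRobustLoudUpgradeStubRealizeTempered
import Summits.AnomalousDissipation.AnomalousDissipation.Theorems.BaireTransferRobustLoudUpgradeStubBudgetLimit
import Summits.AnomalousDissipation.AnomalousDissipation.Theorems.BaireTransferRobustLoudUpgradeTemperedClosed

/-!
# Stub `stub_lhcInterior` of the line `malkin-cone-group-orbits`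
# (crux stmt-AnomalousDissipation-1144, `BaireTransfer.RobustLoudUpgrade`, lead c16, wave 2:
# GENERIC PERSISTENCE FOR ALL WITNESSES)

Lower hemicontinuity of the budget-free lattice-tempered correspondence plus a STRICTLY loud witness
give an interior point of the loud set.  Let `𝚽[S,n] c ⊆ ℝ × ℝ × (ℝ³ × ℓ²(ℤ × ℤ³; ℂ³))` be the set of data
`(ν, τ, m, x)` (viscosity, period, mean `m = ∫u(0)`, weighted lattice state `x = Λû`) of the classical
`τ`-periodic solutions `u` of `NS_ν(f_c)` on `ℝ × T³` in the window `n`.  If `𝚽[S,n]` is lower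
hemicontinuous at `c`, and `c` carries a classical `τ`-periodic witness `u` at `ν ∈ (0,a)` whose datum lies
in `𝚽[S,n] c` with STRICT budgets `meanEnergy u < E`, `ε < meanDissipation ν u`, then
`c ∈ interior (loud S a E ε)`.

Proof.  (1) Slack: `η > 0` with `(1+η)⟨‖u‖²⟩ < E`, `(1+η)ε < ⟨ν‖∇u‖²⟩` (`PeriodicWindow.exists_eta`),
then `δ₁ > 0` with `(1+η⁻¹)δ₁ ≤ E − (1+η)⟨‖u‖²⟩` and `ν(1+η⁻¹)δ₁ ≤ (⟨ν‖∇u‖²⟩ − (1+η)ε)/2`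
(`PeriodicWindow.exists_delta`), so that the dissipation floor
`M = (1+η)⁻¹(⟨ν‖∇u‖²⟩ − ν(1+η⁻¹)δ₁)` is `> ε`; a radius `r = √(δ₁/(6(1+4π²)+2))` for states and means,
and a radius `ρ` for the viscosity keeping `ν' ∈ (0,a)` and `(ν'/ν)M > ε`.
(2) The open box `U = {|ν' − ν| < ρ, ‖m' − ∫u(0)‖ < r, ‖x' − x‖ < r}` meets `𝚽[S,n] c` at the datum of
the witness, so by lower hemicontinuity `𝚽[S,n] c' ∩ U ≠ ∅` for all `c'` near `c`.
(3) For such `c'` pick `(ν', τ', m', x') ∈ 𝚽[S,n] c' ∩ U` with its orbit `u'`; the states `x, x'` are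
members `X, X'` of the state space `W` (`stub_orbitInW`) with `û = X/Λ`, `û' = X'/Λ` (`cw_sw`), and
`‖X' − X‖ = ‖x' − x‖ < r`; the slice `H¹` bound `BudgetLimitAux.close_of_states` gives uniformly in time
`∫‖u'(t) − u(τt/τ')‖² ≤ 6(1+4π²)‖X'−X‖² + 2‖∫u'(0) − ∫u(0)‖² ≤ δ₁` and
`‖∇(u'(t) − u(τt/τ'))‖₂² ≤ 3(1+4π²)‖X'−X‖² ≤ δ₁`.
(4) Peter–Paul transfer (`PeriodicWindow.meanEnergy_le_of_close`, `meanDissipation_ge_of_close`):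
`⟨‖u'‖²⟩ ≤ (1+η)⟨‖u‖²⟩ + (1+η⁻¹)δ₁ ≤ E` and `⟨ν‖∇u'‖²⟩ ≥ M`, whence
`⟨ν'‖∇u'‖²⟩ = (ν'/ν)⟨ν‖∇u'‖²⟩ ≥ (ν'/ν)M > ε` (`BudgetLimitAux.meanDissipation_rescale`); so `c'` is loud.

References: the periodic twin of `Theorems/BaireTransferRobustLoudUpgradeStubLscInterior.lean` (c15) and of
`Theorems/BaireTransferRobustLoudUpgradeStubPeriodicWindow.lean` (`stub_periodicWindow`, whose `η/δ`
bookkeeping is copied); G. Iooss, Arch. Rational Mech. Anal. 47 (1972), §2 (the slice `H¹` embedding, here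
`BudgetLimitAux.close_of_states`); Mathlib `lowerHemicontinuousAt_iff`.
-/

set_option linter.dupNamespace false

noncomputable section

open scoped BigOperators Topology ENNReal NNReal ComplexConjugate
open Filter Set Function TopologicalSpace MeasureTheory UnitAddTorus

namespace Summit.AnomalousDissipation.AnomalousDissipation.Theorems.RobustLoudUpgrade.Tempered

open Literature.Analysis.FunctionSpaces Literature.Analysis.FunctionSpaces.Torus
open Literature.Analysis.FunctionSpaces.EuclideanSpace
open Literature.Analysis.FluidPDE Literature.Analysis.FluidPDE.ScalarFourier
open Literature.Analysis.FluidPDE.TimePeriodicLattice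
open Summit.AnomalousDissipation.AnomalousDissipation.Theses.BaireTransfer
open Summit.AnomalousDissipation.AnomalousDissipation.Theorems.RobustLoudUpgrade

-- NOTATION START (verbatim the local notations of `Literature/Analysis/FluidPDE/PeriodicNSOrbitPersistsProofs.lean`)
/-- The flat unit torus `T³`. -/
local notation "𝕋³" => UnitAddTorus (Fin 3)
/-- Real velocity values. -/
local notation "ℝ³" => EuclideanSpace ℝ (Fin 3)
/-- Complex coefficient values. -/
local notation "ℂ³" => EuclideanSpace ℂ (Fin 3)

/-- Local notation: the parabolic weight `Λ(n, k) = |n| + |k|²`. -/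
local notation:max "Λ" m:max => (|((Prod.fst m : ℤ) : ℝ)| + freqNormSq (Prod.snd m))

/-- Local notation: the convective symbol on `ℤ × ℤ³` (as in `TimePeriodicNSLattice`). -/
local notation:max "𝐍[" a ", " b "]" m:max =>
  (WithLp.toLp 2 (fun p : Fin 3 => ∑ j : Fin 3, ∑' m' : ℤ × (Fin 3 → ℤ),
    a m' j * (dsym j (Prod.snd m - Prod.snd m') * b (m - m') p)) : EuclideanSpace ℂ (Fin 3))

/-- Local notation: division by the weight. -/
local notation:max "𝐜" x:max => (fun mm : ℤ × (Fin 3 → ℤ) =>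
  ((((|((Prod.fst mm : ℤ) : ℝ)| + freqNormSq (Prod.snd mm))⁻¹ : ℝ) : ℂ) • x mm))

/-- Local notation: multiplication by the weight. -/
local notation:max "𝐬" x:max => (fun mm : ℤ × (Fin 3 → ℤ) =>
  ((((|((Prod.fst mm : ℤ) : ℝ)| + freqNormSq (Prod.snd mm)) : ℝ) : ℂ) • x mm))

/-- Local notation: the family of coefficients of `x ∈ W ⊂ ℓ²`. -/
local notation:max "𝐰" x:max =>
  (((x : lp (fun _ : ℤ × (Fin 3 → ℤ) => EuclideanSpace ℂ (Fin 3)) 2)) : ℤ × (Fin 3 → ℤ) → EuclideanSpace ℂ (Fin 3))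

/-- Local notation: the symbol `σ_om(n,k) = 2πi om n + 4π²ν|k|² + 2πi m₀·k`. -/
local notation "σ[" om ", " ν ", " m₀ "]" => (fun mm : ℤ × (Fin 3 → ℤ) =>
  2 * Real.pi * Complex.I * ((om : ℝ) : ℂ) * ((Prod.fst mm : ℤ) : ℂ) +
    (((4 * Real.pi ^ 2 * ν * freqNormSq (Prod.snd mm) : ℝ)) : ℂ) +
    2 * Real.pi * Complex.I * (∑ jj : Fin 3, ((m₀ jj : ℝ) : ℂ) * (((Prod.snd mm) jj : ℤ) : ℂ)))

/-- Local notation: the lattice family of the orbit `u` with period `τ`: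
`û(n,k) = 𝓕(complexify ∘ (timeRoll τ u − ∫ u(0)))(n,k)`. -/
local notation:max "𝐨[" τ ", " u "]" => (fun mm : ℤ × (Fin 3 → ℤ) =>
  mFourierCoeff (EuclideanSpace.complexify ∘ fun y : UnitAddTorus (Fin 4) => Torus.timeRoll τ u y - ∫ x, u 0 x)
    (Fin.cons (Prod.fst mm) (Prod.snd mm) : Fin 4 → ℤ))

/-- Local notation: the force family `y_F(n,k) = [k ≠ 0][n = 0] 𝓕(complexify ∘ F)(k)`. -/
local notation:max "𝐲" F:max => (fun mm : ℤ × (Fin 3 → ℤ) =>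
  (ite (Prod.snd mm = 0) (0 : EuclideanSpace ℂ (Fin 3))
    (ite (Prod.fst mm = 0) (mFourierCoeff (EuclideanSpace.complexify ∘ F) (Prod.snd mm)) 0)))

/-- Local notation: the family of coefficients of an element of `ℓ²(ℤ × ℤ³; ℂ³)`. -/
local notation:max "𝐯" x:max =>
  ((x : lp (fun _ : ℤ × (Fin 3 → ℤ) => EuclideanSpace ℂ (Fin 3)) 2) : ℤ × (Fin 3 → ℤ) → EuclideanSpace ℂ (Fin 3))

/-- Local notation: the BUDGET-FREE LATTICE-TEMPERED CORRESPONDENCE of the window `n` — to a coefficient vector `c` the set of data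
`(ν, τ, m, x)` (viscosity, period, mean, weighted lattice state `x = Λû ∈ ℓ²`) of the classical time-periodic solutions of `NS_ν(f_c)`
with `ν, τ ∈ [1/(n+1), n+1]`, `‖m‖ ≤ n+1`, `Σ Λ‖x‖² ≤ n+1`. -/
local notation "𝚽[" S ", " n "]" => (fun c : Coeff S => setOf
  (fun q : ℝ × ℝ × (EuclideanSpace ℝ (Fin 3) × lp (fun _ : ℤ × (Fin 3 → ℤ) => EuclideanSpace ℂ (Fin 3)) 2) =>
    1 / ((n : ℝ) + 1) ≤ (Prod.fst q) ∧ (Prod.fst q) ≤ (n : ℝ) + 1 ∧ 1 / ((n : ℝ) + 1) ≤ (Prod.fst (Prod.snd q)) ∧ (Prod.fst (Prod.snd q)) ≤ (n : ℝ) + 1 ∧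
    ‖(Prod.fst (Prod.snd (Prod.snd q)))‖ ≤ (n : ℝ) + 1 ∧
    (∑' mm : ℤ × (Fin 3 → ℤ), ENNReal.ofReal (Λ mm) * ‖(𝐯 ((Prod.snd (Prod.snd (Prod.snd q))))) mm‖ₑ ^ 2) ≤ ENNReal.ofReal ((n : ℝ) + 1) ∧
    ∃ (u : ℝ → UnitAddTorus (Fin 3) → EuclideanSpace ℝ (Fin 3)) (p : ℝ → UnitAddTorus (Fin 3) → ℝ),
      IsClassicalNSSolutionOn Set.univ (Prod.fst q) (fun _ => force S c) u p ∧ Function.Periodic u (Prod.fst (Prod.snd q)) ∧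
      (∫ y, u 0 y) = (Prod.fst (Prod.snd (Prod.snd q))) ∧ 𝐯 ((Prod.snd (Prod.snd (Prod.snd q)))) = 𝐬 𝐨[(Prod.fst (Prod.snd q)), u]))
-- NOTATION END

namespace LhcInteriorAux

/-! ## Choice of the radii inside the strict slack -/

/-- Radius for states and means: with `K = 6(1+4π²) + 2` and `r = √(δ/K)`, nonnegative `A, B < r` give
`2·3(1+4π²)A² + 2B² ≤ δ` and `3(1+4π²)A² ≤ δ`. [folklore] -/
theorem exists_radius {δ : ℝ} (hδ : 0 < δ) : ∃ r : ℝ, 0 < r ∧ ∀ A B : ℝ, 0 ≤ A → A < r → 0 ≤ B → B < r →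
    2 * (3 * (1 + 4 * Real.pi ^ 2) * A ^ 2) + 2 * B ^ 2 ≤ δ ∧ 3 * (1 + 4 * Real.pi ^ 2) * A ^ 2 ≤ δ := by
  obtain ⟨K, hKdef⟩ : ∃ K : ℝ, K = 6 * (1 + 4 * Real.pi ^ 2) + 2 := ⟨_, rfl⟩
  have hK : 0 < K := by rw [hKdef]; positivity
  have hdK : 0 < δ / K := div_pos hδ hK
  refine ⟨Real.sqrt (δ / K), Real.sqrt_pos.2 hdK, fun A B hA0 hA hB0 hB => ?_⟩
  have hr2 : Real.sqrt (δ / K) ^ 2 = δ / K := Real.sq_sqrt hdK.le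
  have hA2 : A ^ 2 < δ / K := by rw [← hr2]; exact pow_lt_pow_left₀ hA hA0 two_ne_zero
  have hB2 : B ^ 2 < δ / K := by rw [← hr2]; exact pow_lt_pow_left₀ hB hB0 two_ne_zero
  have hP : 0 ≤ 3 * (1 + 4 * Real.pi ^ 2) := by positivity
  have h1 : 3 * (1 + 4 * Real.pi ^ 2) * A ^ 2 ≤ 3 * (1 + 4 * Real.pi ^ 2) * (δ / K) :=
    mul_le_mul_of_nonneg_left hA2.le hP
  have hKd : (6 * (1 + 4 * Real.pi ^ 2) + 2) * (δ / K) = δ := by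
    rw [← hKdef]; exact mul_div_cancel₀ δ hK.ne'
  have hπ : 0 ≤ Real.pi ^ 2 * (δ / K) := by positivity
  constructor
  · linarith
  · linarith

/-- Radius for the viscosity: near `ν ∈ (0,a)` the viscosity stays in `(0,a)` and the rescaled dissipation
floor `(ν'/ν)M` stays above `ε` when `ε < M`. [folklore] -/
theorem exists_visc_radius {ν a ε M : ℝ} (hν : 0 < ν) (hνa : ν < a) (hM : ε < M) :
    ∃ ρ : ℝ, 0 < ρ ∧ ∀ ν' : ℝ, dist ν' ν < ρ → 0 < ν' ∧ ν' < a ∧ ε < ν' / ν * M := by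
  have h1 : ∀ᶠ ν' in 𝓝 ν, 0 < ν' := eventually_gt_nhds hν
  have h2 : ∀ᶠ ν' in 𝓝 ν, ν' < a := eventually_lt_nhds hνa
  have h3 : ∀ᶠ ν' in 𝓝 ν, ε < ν' / ν * M := by
    have hc : Continuous fun ν' : ℝ => ν' / ν * M := (continuous_id.div_const ν).mul continuous_const
    have ht : Tendsto (fun ν' : ℝ => ν' / ν * M) (𝓝 ν) (𝓝 M) :=
      hc.tendsto' ν M (by rw [div_self hν.ne', one_mul])
    exact ht.eventually_const_lt hM
  obtain ⟨ρ, hρ, h⟩ := Metric.eventually_nhds_iff.1 (h1.and (h2.and h3))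
  exact ⟨ρ, hρ, fun ν' hν' => h hν'⟩

/-- The open box of data around `(ν, ·, m, x)` (no constraint on the period). [folklore] -/
theorem isOpen_box (ν ρ r : ℝ) (m : ℝ³) (x : lp (fun _ : ℤ × (Fin 3 → ℤ) => EuclideanSpace ℂ (Fin 3)) 2) :
    IsOpen {q : ℝ × ℝ × (EuclideanSpace ℝ (Fin 3) × lp (fun _ : ℤ × (Fin 3 → ℤ) => EuclideanSpace ℂ (Fin 3)) 2) |
      dist (Prod.fst q) ν < ρ ∧ dist (Prod.fst (Prod.snd (Prod.snd q))) m < r ∧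
        dist (Prod.snd (Prod.snd (Prod.snd q))) x < r} :=
  (isOpen_lt (continuous_fst.dist continuous_const) continuous_const).and
    ((isOpen_lt ((continuous_fst.comp (continuous_snd.comp continuous_snd)).dist continuous_const)
      continuous_const).and
      (isOpen_lt ((continuous_snd.comp (continuous_snd.comp continuous_snd)).dist continuous_const)
        continuous_const))

/-- The norm of a difference in `W` is the `ℓ²` distance of the ambient values. [folklore] -/
theorem norm_sub_eq {W : Submodule ℝ (lp (fun _ : ℤ × (Fin 3 → ℤ) => EuclideanSpace ℂ (Fin 3)) 2)} (X X' : W)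
    {x x' : lp (fun _ : ℤ × (Fin 3 → ℤ) => EuclideanSpace ℂ (Fin 3)) 2}
    (hX : (X : lp (fun _ : ℤ × (Fin 3 → ℤ) => EuclideanSpace ℂ (Fin 3)) 2) = x)
    (hX' : (X' : lp (fun _ : ℤ × (Fin 3 → ℤ) => EuclideanSpace ℂ (Fin 3)) 2) = x') :
    ‖X' - X‖ = dist x' x := by
  rw [Submodule.coe_norm, Submodule.coe_sub, hX, hX', dist_eq_norm]

end LhcInteriorAux

/-- **stub_lhcInterior** (lower hemicontinuity + a STRICTLY loud witness ⇒ interior; the periodic twin of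
c15's `stub_lscInterior`; registered stub of the line `malkin-cone-group-orbits`, lead c16, wave 2): if the
budget-free lattice-tempered correspondence `𝚽[S,n]` is lower hemicontinuous at `c` and `c` carries a
classical `τ`-periodic witness at `ν ∈ (0,a)` whose datum `(ν, τ, ∫u(0), Λû)` lies in the window `n` with
STRICT budgets `meanEnergy u < E`, `ε < meanDissipation ν u`, then `c ∈ interior (loud S a E ε)`: nearby
forces carry window-`n` orbits with `ℓ²`-close states, close viscosities and means (lower hemicontinuity
against a small open box), whose budgets stay inside the strict slack by the slice `H¹` bound
(`BudgetLimitAux.close_of_states`) and the Peter–Paul transfer (`PeriodicWindow.meanEnergy_le_of_close /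
meanDissipation_ge_of_close`, `BudgetLimitAux.meanDissipation_rescale`, `PeriodicWindow.exists_eta /
exists_delta`). [folklore] -/
theorem stub_lhcInterior : ∀ (S : Finset (Fin 3 → ℤ)) (n : ℕ) (a E ε : ℝ) (c : Coeff S),
    LowerHemicontinuousAt 𝚽[S, n] c →
    ∀ (ν τ : ℝ) (u : ℝ → 𝕋³ → ℝ³) (p : ℝ → 𝕋³ → ℝ) (x : lp (fun _ : ℤ × (Fin 3 → ℤ) => EuclideanSpace ℂ (Fin 3)) 2),
      0 < ν → ν < a → 0 < τ → IsClassicalNSSolutionOn Set.univ ν (fun _ => force S c) u p → Function.Periodic u τ →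
      ((ν, τ, ((∫ y, u 0 y), x)) : ℝ × ℝ × (EuclideanSpace ℝ (Fin 3) × lp (fun _ : ℤ × (Fin 3 → ℤ) => EuclideanSpace ℂ (Fin 3)) 2))
        ∈ 𝚽[S, n] c →
      𝐯 x = 𝐬 𝐨[τ, u] → meanEnergy u < E → ε < meanDissipation ν u → c ∈ interior (loud S a E ε) := by
  intro S n a E ε c hlhc ν τ u p x hν hνa hτ hsol hper hmem hx hE hD
  have hu := hsol.smooth_velocity
  -- (1) the slack: `η`, then `δ₁`, the dissipation floor `M`, and the radii `r`, `ρ`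
  obtain ⟨η, hη, hηE, hηD⟩ := PeriodicWindow.exists_eta hE hD
  obtain ⟨δ₁, hδ₁, hδE, hδD⟩ := PeriodicWindow.exists_delta (sE := E - (1 + η) * meanEnergy u)
    (sD := (meanDissipation ν u - (1 + η) * ε) / 2) (by linarith) (by linarith) hν hη
  have hη1 : 0 < 1 + η := by linarith
  obtain ⟨M, hMdef⟩ : ∃ M : ℝ, M = (1 + η)⁻¹ * (meanDissipation ν u - ν * ((1 + η⁻¹) * δ₁)) := ⟨_, rfl⟩
  have hεM : ε < M := by
    rw [hMdef, lt_inv_mul_iff₀ hη1]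
    linarith
  obtain ⟨r, hr, hrad⟩ := LhcInteriorAux.exists_radius hδ₁
  obtain ⟨ρ, hρ, hvisc⟩ := LhcInteriorAux.exists_visc_radius hν hνa hεM
  -- (2) the open box around the datum of the witness, and lower hemicontinuity at `c`
  obtain ⟨U, hU⟩ : ∃ U : Set (ℝ × ℝ × (EuclideanSpace ℝ (Fin 3) × lp (fun _ : ℤ × (Fin 3 → ℤ) => EuclideanSpace ℂ (Fin 3)) 2)),
      U = {q | dist (Prod.fst q) ν < ρ ∧ dist (Prod.fst (Prod.snd (Prod.snd q))) (∫ y, u 0 y) < r ∧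
        dist (Prod.snd (Prod.snd (Prod.snd q))) x < r} := ⟨_, rfl⟩
  have hUo : IsOpen U := by rw [hU]; exact LhcInteriorAux.isOpen_box ν ρ r (∫ y, u 0 y) x
  have hne : (𝚽[S, n] c ∩ U).Nonempty :=
    ⟨(ν, τ, ((∫ y, u 0 y), x)), hmem, by rw [hU]; exact ⟨by simpa using hρ, by simpa using hr, by simpa using hr⟩⟩
  have h1 := (lowerHemicontinuousAt_iff.1 hlhc) U hUo hne
  -- (3) the state space and the state of the witness
  obtain ⟨W, hW, -⟩ := exists_space
  obtain ⟨X, hX, -⟩ := stub_orbitInW hW c hτ hsol hper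
  have hXx : (X : lp (fun _ : ℤ × (Fin 3 → ℤ) => EuclideanSpace ℂ (Fin 3)) 2) = x :=
    lp.ext (hX.trans hx.symm)
  have hzero : ∀ k : ℤ, 𝐨[τ, u] (k, 0) = 0 := fun k =>
    orbit_zero_modes hsol hper (SteadyPersist.hasZeroMean_force' _) k
  have hxc : 𝐨[τ, u] = 𝐜 (𝐰 X) := by rw [hX]; exact (cw_sw (x := 𝐨[τ, u]) hzero).symm
  -- (4) every nearby `c'` is loud
  rw [mem_interior_iff_mem_nhds]
  filter_upwards [h1] with c' hc'
  obtain ⟨⟨ν', τ', m', x'⟩, hq, hqU⟩ := hc'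
  simp only [Set.mem_setOf_eq] at hq
  obtain ⟨hν'1, -, hτ'1, -, -, -, u', p', hsol', hper', hmean', hx'⟩ := hq
  simp only [hU, Set.mem_setOf_eq] at hqU
  obtain ⟨hν'ν, hm', hx'x⟩ := hqU
  have hn1 : (0 : ℝ) < 1 / ((n : ℝ) + 1) := one_div_pos.2 (by positivity)
  have hτ' : 0 < τ' := hn1.trans_le hτ'1
  obtain ⟨hν'0, hν'a, hν'M⟩ := hvisc ν' hν'ν
  have hu' := hsol'.smooth_velocity
  -- the state of the nearby orbit, and the uniform-in-time closeness of the two orbits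
  obtain ⟨X', hX', -⟩ := stub_orbitInW hW c' hτ' hsol' hper'
  have hX'x : (X' : lp (fun _ : ℤ × (Fin 3 → ℤ) => EuclideanSpace ℂ (Fin 3)) 2) = x' :=
    lp.ext (hX'.trans hx'.symm)
  have hzero' : ∀ k : ℤ, 𝐨[τ', u'] (k, 0) = 0 := fun k =>
    orbit_zero_modes hsol' hper' (SteadyPersist.hasZeroMean_force' _) k
  have hx'c : 𝐨[τ', u'] = 𝐜 (𝐰 X') := by rw [hX']; exact (cw_sw (x := 𝐨[τ', u']) hzero').symm
  have hnX : ‖X' - X‖ < r := by rw [LhcInteriorAux.norm_sub_eq X X' hXx hX'x]; exact hx'x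
  have hnm : ‖(∫ y, u' 0 y) - ∫ y, u 0 y‖ < r := by rw [hmean', ← dist_eq_norm]; exact hm'
  obtain ⟨hbE, hbD⟩ :=
    hrad ‖X' - X‖ ‖(∫ y, u' 0 y) - ∫ y, u 0 y‖ (norm_nonneg _) hnX (norm_nonneg _) hnm
  have hcloseE : ∀ t, ∫ z, ‖u' t z - u (τ / τ' * t) z‖ ^ 2 ≤ δ₁ := fun t =>
    (BudgetLimitAux.close_of_states hW hτ' hu' hper' hu hper X' X hx'c hxc t).1.trans hbE
  have hcloseD : ∀ t, gradNormSq (fun z => u' t z - u (τ / τ' * t) z) ≤ δ₁ := fun t =>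
    (BudgetLimitAux.close_of_states hW hτ' hu' hper' hu hper X' X hx'c hxc t).2.trans hbD
  -- (5) budgets of the nearby orbit at the nearby viscosity
  refine ⟨ν', hν'0, hν'a, τ', u', p', hτ', hsol', hper', ?_, ?_⟩
  · have h := PeriodicWindow.meanEnergy_le_of_close hu hper hτ hu' hper' hτ' hη hcloseE
    linarith
  · have h := PeriodicWindow.meanDissipation_ge_of_close hu hper hτ hu' hper' hτ' hν.le hη hcloseD
    rw [← hMdef] at h
    have hresc : meanDissipation ν' u' = ν' / ν * meanDissipation ν u' :=
      BudgetLimitAux.meanDissipation_rescale hu' hper' hτ' hν.ne'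
    have h2 : ν' / ν * M ≤ ν' / ν * meanDissipation ν u' :=
      mul_le_mul_of_nonneg_left h (div_pos hν'0 hν).le
    rw [hresc]
    linarith

end Summit.AnomalousDissipation.AnomalousDissipation.Theorems.RobustLoudUpgrade.Tempered

end
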